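/-
Copyright (c) 2026 the pub-hodgecm-mathlib formalisation cell (harness21).  Prover seat hodgecm-mathlib-K2E3-p11 (g4),
Track B «K2-LIT» ∕ h413 (`stmt-HodgeConjecture-24833`), line `K2_E3_EllipticInputs`, unit U12 §L, kernel road «RICHARDSON» for (L-B_GL)
(`sig_K2E3GLnNilpotentFourierRegular`), brick (R2), Lie side: THE RICHARDSON NILPOTENT AVERAGE `Λ_c(f) = ∫_{K×U_c} f(k (u − 1) k⁻¹)` ON `𝔤𝔩_n(F)` IS
`Ad(GL_n(F))`-INVARIANT — every two-block parabolic `P_c`, every `n`.  2026-09-04.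
-/
import Summits.HodgeConjecture.HodgeConjecture.Theorems.K2E3GLnRichardsonMeasureAdInvariant   -- ★ p857336 (this seat): `GLn.unipotentAverage_comp_conj_eq` (group side)
import Summits.HodgeConjecture.HodgeConjecture.Theorems.K2E3GL2RegularNilpotentOrbitalMeasure  -- ★ p856734 (§L lead): `isCompact_preimage_val_of_det` (any `n`)
import Literature.NumberTheory.Automorphic.GLnCongruenceSubgroups                             -- ★ `sub_one_apply_eq_zero_of_mem_unipotentRadicalGL`
import Literature.LinearAlgebra.Matrix.RegularSemisimpleConjClassClosed                        -- ★ `continuous_charpoly_coeff`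
import Literature.NumberTheory.Rogawski1990.LocalTransferGlue                                  -- ★ `IsLocSmooth.indicator`
import HarnessLib

/-!
# K2_E3 road (h413), §L — kernel road «RICHARDSON» for (L-B_GL), brick (R2), LIE SIDE:
# `Λ_c(f) := ∫_{GL_n(𝒪) × U_c} f(k (u − 1) k⁻¹) d(κ ⊗ μ_U)` on `𝔤𝔩_n(F)` is `Ad(GL_n(F))`-invariant

Cell `pub/hodgecm-mathlib` (D-0151), Track B (21-frontier RULING «PUSH BOTH» 2026-09-03, director req624), seat K2E3-p11 (g4), road owner «RICHARDSON» (dealer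
K2E3-plan (g3) «=» 04:11Z).  `--supports stmt-HodgeConjecture-24833 --as helper`; THEOREMS ONLY; never imports `Cruxes/…/Lines`.  COUNT-NEUTRAL.
This is the `𝔤𝔩_n` ∕ two-block twin of the §L lead's ★ `K2E3GL2RegularNilpotentOrbitalMeasure.nilpotentAverage_conj` (the case `n = 2`, `P = B`), by the SAME
dictionary, over the group-side invariance ★ p857336 `GLn.unipotentAverage_comp_conj_eq`.

THE MATHEMATICS.  For a monotone two-block labelling `c : Fin n → Bool` the unipotent radical `U_c` is ABELIAN and `u ↦ u − 1` identifies `(U_c, ·)` with the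
nilpotent block `(𝔫_c, +)` (`(u − 1)(u′ − 1) = 0`), so the RICHARDSON MEASURE of the nilpotent orbit `Ad(GL_n) · 𝔫_c` in Rao's `K × 𝔫` form is
`Λ_c(f) = ∫_{K × U_c} f(k (u − 1) k⁻¹) d(κ ⊗ μ_U)` for Haar measures `κ` on `K = GL_n(𝒪)` and `μ_U` on `U_c` (any `f : 𝔤𝔩_n(F) → ℂ`).  CLAIM
(**`GLn.nilpotentAverage_comp_conj_eq`**): `Λ_c(f ∘ Ad x) = Λ_c(f)` for `f ∈ C_c^∞(𝔤𝔩_n(F))`, `x ∈ GL_n(F)`.  PROOF (dictionary): with the `Ad`-INVARIANT CLOPEN CUT-OFF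
`W := {X | every non-leading coefficient of charpoly X lies in 𝔭}` — which contains the nilpotent cone (`charpoly = tⁿ`) and on which `det(1 + X) ∈ 1 + 𝔭` is a unit
(`det(1 + X) = (−1)ⁿ · charpoly_X(−1)`) — the function `g(u) := (1_W f)(u − 1)` is locally constant with COMPACT support on `GL_n(F)` (★ `isCompact_preimage_val_of_det`),
reads `f(k (u − 1) k⁻¹)` at `k u k⁻¹` and `f(x k (u − 1) k⁻¹ x⁻¹)` at `x k u k⁻¹ x⁻¹` (`(y v y⁻¹) − 1 = y (v − 1) y⁻¹`, and these points lie in `W`), so ★ p857336 applies.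
* §1 `sub_one_mul_sub_one_eq_zero`, `isNilpotent_coe_sub_one`, `charpoly_coe_sub_one` — `u − 1` is square-zero for `u ∈ U_c`; `coe_conj_sub_one` — the dictionary.
* §2 the cut-off `W`: `isClopen_charpolyCutoff`, `conj_mem_charpolyCutoff_iff`, `mem_charpolyCutoff_of_isNilpotent`, `isUnit_det_one_add_of_mem_charpolyCutoff`.
* §3 **`GLn.nilpotentAverage_comp_conj_eq`**.
With ★ R1a∕R1b (K2E3-p21 (g4) `smulInvariantMeasure_comap_val (hΛ : ∀ g, Λ.map (Ad g) = Λ)`) this is the invariance input for the Richardson measures of the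
minimal orbit of `𝔤𝔩₃` (`c` = the `(2,1)` and `(1,2)` labellings); the regular orbit (Borel, three blocks) needs the staged version (OPEN).

References: [HarishChandra1999AdmissibleDistributions] Harish-Chandra (DeBacker–Sally), *Admissible invariant distributions on reductive p-adic groups* (1999), §3
pp. 8–10 (Deligne–Rao; nilpotent orbital integrals are invariant Radon measures), Thm. 4.4 · [Rogawski1990] §4.13 L. 4.13.1, §8.1 p. 112 · [Howe1974] §2.
HONEST LABEL: HC_CM is proved only modulo the 7 printed citations (2 remaining named inputs: hLiu418 = stmt-HodgeConjecture-24832, h413 = stmt-HodgeConjecture-24833)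
until rung 0 closes; count-neutral helper.
-/

set_option autoImplicit false
set_option linter.dupNamespace false   -- `Summit.HodgeConjecture.HodgeConjecture.…` (D-0017 nested layout; lakefile exemption for Summits)

noncomputable section

open MeasureTheory MeasureTheory.Measure Filter Topology Set Polynomial
open scoped MatrixGroups NNReal ENNReal
open Literature.NumberTheory.Automorphic Literature.NumberTheory.Automorphic.LocalFieldHaar Literature.NumberTheory.Rogawski1990 Literature.LinearAlgebra.Matrix
open Literature.NumberTheory.GaloisRepresentations Literature.NumberTheory.GaloisRepresentations.IsNonarchimedeanLocalField
open Summit.HodgeConjecture.HodgeConjecture.Cruxes.H413.K2E3GLnRichardsonMeasureAdInvariant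
open Summit.HodgeConjecture.HodgeConjecture.Cruxes.H413.K2E3GL2RegularNilpotentOrbitalMeasure

namespace Summit.HodgeConjecture.HodgeConjecture.Cruxes.H413.K2E3GLnRichardsonLieMeasureAdInvariant

/-! ## §1  `u − 1` for `u ∈ U_c` (two blocks): square zero, nilpotent, `charpoly = tⁿ`; the dictionary `(y v y⁻¹) − 1 = y (v − 1) y⁻¹` -/

section Algebra

variable {F : Type*} [Field F] {n : ℕ} {c : Fin n → Bool}

/-- For `u` in the unipotent radical of a TWO-block parabolic, the entries of `u − 1` vanish unless `(c i, c j) = (false, true)`. [cite: BernsteinZelevinsky1977, §2.1] -/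
theorem coe_sub_one_apply_eq_zero {u : GL (Fin n) F} (hu : u ∈ unipotentRadicalGL F c) (i j : Fin n) (h : ¬ (c i = false ∧ c j = true)) :
    ((u : Matrix (Fin n) (Fin n) F) - 1) i j = 0 := by
  refine sub_one_apply_eq_zero_of_mem_unipotentRadicalGL hu ?_
  cases hci : c i <;> cases hcj : c j <;> simp_all

/-- **`(u − 1)(u′ − 1) = 0`** for `u, u′ ∈ U_c` (two blocks): the nilpotent block `𝔫_c` has trivial multiplication. [cite: BernsteinZelevinsky1977, §2.1] -/
theorem sub_one_mul_sub_one_eq_zero {u u' : GL (Fin n) F} (hu : u ∈ unipotentRadicalGL F c) (hu' : u' ∈ unipotentRadicalGL F c) :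
    ((u : Matrix (Fin n) (Fin n) F) - 1) * ((u' : Matrix (Fin n) (Fin n) F) - 1) = 0 := by
  ext i j
  rw [Matrix.mul_apply, Matrix.zero_apply]
  refine Finset.sum_eq_zero fun k _ => ?_
  by_cases h1 : c i = false ∧ c k = true
  · have h2 : ¬ (c k = false ∧ c j = true) := fun h => by rw [h1.2] at h; exact Bool.noConfusion h.1
    rw [coe_sub_one_apply_eq_zero hu' k j h2, mul_zero]
  · rw [coe_sub_one_apply_eq_zero hu i k h1, zero_mul]

/-- `u − 1` is nilpotent for `u ∈ U_c`. [cite: BernsteinZelevinsky1977, §2.1] -/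
theorem isNilpotent_coe_sub_one {u : GL (Fin n) F} (hu : u ∈ unipotentRadicalGL F c) :
    IsNilpotent ((u : Matrix (Fin n) (Fin n) F) - 1) :=
  ⟨2, by rw [pow_two, sub_one_mul_sub_one_eq_zero hu hu]⟩

/-- `charpoly (u − 1) = tⁿ` for `u ∈ U_c`. [cite: BernsteinZelevinsky1977, §2.1] -/
theorem charpoly_coe_sub_one {u : GL (Fin n) F} (hu : u ∈ unipotentRadicalGL F c) :
    ((u : Matrix (Fin n) (Fin n) F) - 1).charpoly = X ^ n := by
  have h := (Matrix.isNilpotent_charpoly_sub_pow_of_isNilpotent (isNilpotent_coe_sub_one hu)).eq_zero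
  rw [sub_eq_zero] at h
  simpa using h

/-- **The dictionary**: `(y v y⁻¹) − 1 = y (v − 1) y⁻¹` in `M_n(F)` for `y, v ∈ GL_n(F)`. [folklore] -/
theorem coe_conj_sub_one (y v : GL (Fin n) F) :
    (((y * v * y⁻¹ : GL (Fin n) F)) : Matrix (Fin n) (Fin n) F) - 1 =
      (y : Matrix (Fin n) (Fin n) F) * ((v : Matrix (Fin n) (Fin n) F) - 1) * ((y⁻¹ : GL (Fin n) F) : Matrix (Fin n) (Fin n) F) := by
  have hyy : (y : Matrix (Fin n) (Fin n) F) * ((y⁻¹ : GL (Fin n) F) : Matrix (Fin n) (Fin n) F) = 1 := by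
    rw [← Units.val_mul, mul_inv_cancel, Units.val_one]
  rw [Units.val_mul, Units.val_mul, Matrix.mul_sub, Matrix.sub_mul, Matrix.mul_one, hyy]

end Algebra

/-! ## §2  The `Ad`-invariant clopen cut-off `W = {X | the non-leading coefficients of charpoly X lie in 𝔭}` -/

section Cutoff

variable {F : Type*} [Field F] [ValuativeRel F] [TopologicalSpace F] [IsNonarchimedeanLocalField F] {n : ℕ}

/-- `W` is clopen (finitely many continuous coefficient conditions against the clopen ideal `𝔭`). [cite: HarishChandra1999AdmissibleDistributions, §3 p. 9] -/
theorem isClopen_charpolyCutoff :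
    IsClopen {X : Matrix (Fin n) (Fin n) F | ∀ k ∈ Finset.range n, X.charpoly.coeff k ∈ primePowBall F 1} := by
  haveI : IsTopologicalRing F := inferInstance
  have h : {X : Matrix (Fin n) (Fin n) F | ∀ k ∈ Finset.range n, X.charpoly.coeff k ∈ primePowBall F 1} =
      ⋂ k ∈ Finset.range n, {X : Matrix (Fin n) (Fin n) F | X.charpoly.coeff k ∈ primePowBall F 1} := by
    ext X; simp only [Set.mem_setOf_eq, Set.mem_iInter]
  rw [h]
  exact ⟨isClosed_biInter fun k _ => (isClosed_primePowBall 1).preimage (continuous_charpoly_coeff k),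
    isOpen_biInter_finset fun k _ => (isOpen_primePowBall 1).preimage (continuous_charpoly_coeff k)⟩

omit [ValuativeRel F] [TopologicalSpace F] [IsNonarchimedeanLocalField F] in
/-- `charpoly (y X y⁻¹) = charpoly X` for `y ∈ GL_n(F)` (Mathlib `Matrix.charpoly_units_conj`, units form). [folklore] -/
theorem charpoly_units_conj_coe (y : GL (Fin n) F) (X : Matrix (Fin n) (Fin n) F) :
    ((y : Matrix (Fin n) (Fin n) F) * X * ((y⁻¹ : GL (Fin n) F) : Matrix (Fin n) (Fin n) F)).charpoly = X.charpoly := by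
  rw [Matrix.coe_units_inv]
  exact Matrix.charpoly_units_conj y X

/-- `W` is `Ad(GL_n(F))`-invariant. [cite: HarishChandra1999AdmissibleDistributions, §3 p. 9] -/
theorem conj_mem_charpolyCutoff_iff (y : GL (Fin n) F) (X : Matrix (Fin n) (Fin n) F) :
    (y : Matrix (Fin n) (Fin n) F) * X * ((y⁻¹ : GL (Fin n) F) : Matrix (Fin n) (Fin n) F) ∈
        {X : Matrix (Fin n) (Fin n) F | ∀ k ∈ Finset.range n, X.charpoly.coeff k ∈ primePowBall F 1} ↔
      X ∈ {X : Matrix (Fin n) (Fin n) F | ∀ k ∈ Finset.range n, X.charpoly.coeff k ∈ primePowBall F 1} := by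
  simp only [Set.mem_setOf_eq, charpoly_units_conj_coe]

/-- `W` contains every nilpotent matrix (`charpoly = tⁿ`). [cite: HarishChandra1999AdmissibleDistributions, §3 p. 9] -/
theorem mem_charpolyCutoff_of_isNilpotent {X : Matrix (Fin n) (Fin n) F} (hX : IsNilpotent X) :
    X ∈ {X : Matrix (Fin n) (Fin n) F | ∀ k ∈ Finset.range n, X.charpoly.coeff k ∈ primePowBall F 1} := by
  have h : X.charpoly = Polynomial.X ^ n := by
    have h := (Matrix.isNilpotent_charpoly_sub_pow_of_isNilpotent hX).eq_zero
    rw [sub_eq_zero] at h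
    simpa using h
  intro k hk
  rw [Finset.mem_range] at hk
  rw [h, Polynomial.coeff_X_pow, if_neg (Nat.ne_of_lt hk)]
  exact zero_mem_primePowBall 1

/-- **`det(1 + X)` is a unit on `W`**: `(−1)ⁿ det(1 + X) = charpoly_X(−1) = (−1)ⁿ + Σ_{k<n} a_k (−1)^k` with all `a_k ∈ 𝔭`, so `det(1 + X) ∈ 1 + 𝔭`.
[cite: HarishChandra1999AdmissibleDistributions, §3 p. 9] -/
theorem isUnit_det_one_add_of_mem_charpolyCutoff {X : Matrix (Fin n) (Fin n) F}
    (hX : X ∈ {X : Matrix (Fin n) (Fin n) F | ∀ k ∈ Finset.range n, X.charpoly.coeff k ∈ primePowBall F 1}) :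
    IsUnit (1 + X).det := by
  -- `charpoly_X(-1) = (-1)^n det (1 + X)`
  have heval : X.charpoly.eval (-1) = (-1) ^ n * (1 + X).det := by
    rw [Matrix.eval_charpoly]
    have h1 : Matrix.scalar (Fin n) (-1 : F) - X = -(1 + X) := by
      rw [map_neg, map_one, neg_add']
    rw [h1, Matrix.det_neg, Fintype.card_fin]
  -- `charpoly_X(-1) = s + (-1)^n` with `s ∈ 𝔭`
  set s : F := ∑ i ∈ Finset.range n, X.charpoly.coeff i * (-1) ^ i with hs_def
  have hmonic : X.charpoly.coeff n = 1 := by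
    have h := (Matrix.charpoly_monic X).coeff_natDegree
    rwa [Matrix.charpoly_natDegree_eq_dim, Fintype.card_fin] at h
  have hsum : X.charpoly.eval (-1) = s + (-1) ^ n := by
    rw [Polynomial.eval_eq_sum_range, Matrix.charpoly_natDegree_eq_dim, Fintype.card_fin, Finset.sum_range_succ, hmonic, one_mul]
  have hs : s ∈ primePowBall F 1 := by
    refine sum_mem_primePowBall (Finset.range n) fun i hi => ?_
    rw [mem_primePowBall_iff, map_mul, map_pow, normAbs_neg, map_one, one_pow, mul_one, ← mem_primePowBall_iff]
    exact hX i hi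
  -- `det(1 + X) = 1 + (-1)^n s`, `‖(-1)^n s‖ < 1`
  have hpow : ((-1 : F) ^ n) * (-1) ^ n = 1 := by rw [← pow_add, ← two_mul, pow_mul, neg_one_sq, one_pow]
  have hdet : (1 + X).det = 1 + (-1) ^ n * s := by
    have h := heval.symm.trans hsum
    have h2 : (-1 : F) ^ n * ((-1) ^ n * (1 + X).det) = (-1) ^ n * (s + (-1) ^ n) := congrArg (fun y => (-1 : F) ^ n * y) h
    rw [← mul_assoc, hpow, one_mul] at h2
    rw [h2, mul_add, hpow, add_comm]
  have hsmall : normAbs F ((-1) ^ n * s) < normAbs F (1 : F) := by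
    rw [map_one, map_mul, map_pow, normAbs_neg, map_one, one_pow, one_mul]
    have h := hs
    rw [mem_primePowBall_iff, zpow_one] at h
    exact lt_of_le_of_lt h inv_residueFieldCard_lt_one
  rw [hdet, isUnit_iff_ne_zero]
  intro h0
  have h1 := normAbs_add_eq_of_lt hsmall
  rw [h0, map_zero, map_one] at h1
  exact zero_ne_one h1

end Cutoff

/-! ## §3  The Richardson nilpotent average on `𝔤𝔩_n(F)` is `Ad`-invariant -/

section Main

variable {F : Type*} [Field F] [ValuativeRel F] [TopologicalSpace F] [IsNonarchimedeanLocalField F]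
  [MeasurableSpace F] [BorelSpace F]
  {n : ℕ} {c : Fin n → Bool} [MeasurableSpace (GL (Fin n) F)] [BorelSpace (GL (Fin n) F)]

/-- **(R2), LIE SIDE: `Λ_c(f ∘ Ad x) = Λ_c(f)`.**  For a monotone two-block labelling `c` of `GL_n(F)` (`F` non-archimedean local), Haar measures `κ` on `GL_n(𝒪)`
and `μ_U` on `U_c`, every `f ∈ C_c^∞(𝔤𝔩_n(F))` and every `x ∈ GL_n(F)`:
`∫_{K×U_c} f(x · k (u − 1) k⁻¹ · x⁻¹) d(κ ⊗ μ_U) = ∫_{K×U_c} f(k (u − 1) k⁻¹) d(κ ⊗ μ_U)` — the Richardson measure of the nilpotent orbit `Ad(GL_n)·𝔫_c`, in Rao's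
`K × 𝔫_c ≅ K × U_c` form, is an INVARIANT distribution on `𝔤𝔩_n(F)` (dictionary over ★ p857336).
[cite: HarishChandra1999AdmissibleDistributions, §3 p. 9, Thm. 4.4 p. 11] [cite: Rogawski1990, §8.1 p. 112] -/
theorem GLn.nilpotentAverage_comp_conj_eq (hc : Monotone c)
    (κ : Measure ↥(glInt n F)) [IsHaarMeasure κ] (μN : Measure ↥(unipotentRadicalGL F c)) [IsHaarMeasure μN]
    {f : Matrix (Fin n) (Fin n) F → ℂ} (hf : IsLocSmooth f) (x : GL (Fin n) F) :
    ∫ q : ↥(glInt n F) × ↥(unipotentRadicalGL F c),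
        f ((x : Matrix (Fin n) (Fin n) F) * ((((q.1 : GL (Fin n) F)) : Matrix (Fin n) (Fin n) F) *
          ((((q.2 : GL (Fin n) F)) : Matrix (Fin n) (Fin n) F) - 1) * ((((q.1 : GL (Fin n) F))⁻¹ : GL (Fin n) F) : Matrix (Fin n) (Fin n) F)) *
          ((x⁻¹ : GL (Fin n) F) : Matrix (Fin n) (Fin n) F)) ∂(κ.prod μN) =
      ∫ q : ↥(glInt n F) × ↥(unipotentRadicalGL F c),
        f ((((q.1 : GL (Fin n) F)) : Matrix (Fin n) (Fin n) F) * ((((q.2 : GL (Fin n) F)) : Matrix (Fin n) (Fin n) F) - 1) *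
          ((((q.1 : GL (Fin n) F))⁻¹ : GL (Fin n) F) : Matrix (Fin n) (Fin n) F)) ∂(κ.prod μN) := by
  classical
  haveI : T2Space F := (isLocalField F).toT2Space
  haveI : T2Space (GL (Fin n) F) := t2Space_generalLinearGroup F n
  -- the cut-off
  set W : Set (Matrix (Fin n) (Fin n) F) := {X | ∀ k ∈ Finset.range n, X.charpoly.coeff k ∈ primePowBall F 1} with hW
  have hWclopen : IsClopen W := isClopen_charpolyCutoff
  have hWconj : ∀ (y : GL (Fin n) F) (X : Matrix (Fin n) (Fin n) F),
      (y : Matrix (Fin n) (Fin n) F) * X * ((y⁻¹ : GL (Fin n) F) : Matrix (Fin n) (Fin n) F) ∈ W ↔ X ∈ W :=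
    conj_mem_charpolyCutoff_iff
  have hWu : ∀ u : ↥(unipotentRadicalGL F c), (((u : GL (Fin n) F)) : Matrix (Fin n) (Fin n) F) - 1 ∈ W :=
    fun u => mem_charpolyCutoff_of_isNilpotent (isNilpotent_coe_sub_one u.2)
  -- the group-side test function `g(v) = (1_W f)(v - 1)`
  set f₁ : Matrix (Fin n) (Fin n) F → ℂ := W.indicator f with hf₁
  have hf₁sm : IsLocSmooth f₁ := IsLocSmooth.indicator hf hWclopen
  set g : GL (Fin n) F → ℂ := fun v => f₁ ((v : Matrix (Fin n) (Fin n) F) - 1) with hg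
  have hglc : IsLocallyConstant g := hf₁sm.1.comp_continuous (Units.continuous_val.sub continuous_const)
  have hgcs : HasCompactSupport g := by
    set D : Set (Matrix (Fin n) (Fin n) F) := (fun X => X + 1) '' (W ∩ tsupport f) with hD
    have hDc : IsCompact D := (hf.2.inter_left hWclopen.1).image (continuous_id.add continuous_const)
    have hDdet : ∀ M ∈ D, IsUnit M.det := by
      rintro M ⟨X, ⟨hXW, -⟩, rfl⟩
      show IsUnit (X + 1).det
      rw [add_comm]
      exact isUnit_det_one_add_of_mem_charpolyCutoff hXW
    refine IsCompact.of_isClosed_subset (isCompact_preimage_val_of_det hDc hDdet) (isClosed_tsupport _)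
      (closure_minimal (fun v hv => ?_) ((hDc.isClosed).preimage Units.continuous_val))
    have hv' : (v : Matrix (Fin n) (Fin n) F) - 1 ∈ W ∩ tsupport f := by
      have hne : f₁ ((v : Matrix (Fin n) (Fin n) F) - 1) ≠ 0 := hv
      by_cases hW' : (v : Matrix (Fin n) (Fin n) F) - 1 ∈ W
      · exact ⟨hW', subset_tsupport _ (by rwa [hf₁, Set.indicator_of_mem hW'] at hne)⟩
      · exact absurd (by rw [hf₁, Set.indicator_of_notMem hW']) hne
    exact ⟨_, hv', by simp⟩
  -- dictionary: `g(y (k u k⁻¹) y⁻¹) = f(y (k (u − 1) k⁻¹) y⁻¹)`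
  have hread : ∀ (y : GL (Fin n) F) (q : ↥(glInt n F) × ↥(unipotentRadicalGL F c)),
      g (y * ((q.1 : GL (Fin n) F) * (q.2 : GL (Fin n) F) * (q.1 : GL (Fin n) F)⁻¹) * y⁻¹) =
        f ((y : Matrix (Fin n) (Fin n) F) * ((((q.1 : GL (Fin n) F)) : Matrix (Fin n) (Fin n) F) *
          ((((q.2 : GL (Fin n) F)) : Matrix (Fin n) (Fin n) F) - 1) * ((((q.1 : GL (Fin n) F))⁻¹ : GL (Fin n) F) : Matrix (Fin n) (Fin n) F)) *
          ((y⁻¹ : GL (Fin n) F) : Matrix (Fin n) (Fin n) F)) := by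
    intro y q
    show f₁ _ = _
    rw [coe_conj_sub_one, coe_conj_sub_one, hf₁, Set.indicator_of_mem ((hWconj y _).2 ((hWconj _ _).2 (hWu q.2)))]
  have h1 : ∀ q : ↥(glInt n F) × ↥(unipotentRadicalGL F c),
      g ((q.1 : GL (Fin n) F) * (q.2 : GL (Fin n) F) * (q.1 : GL (Fin n) F)⁻¹) =
        f ((((q.1 : GL (Fin n) F)) : Matrix (Fin n) (Fin n) F) * ((((q.2 : GL (Fin n) F)) : Matrix (Fin n) (Fin n) F) - 1) *
          ((((q.1 : GL (Fin n) F))⁻¹ : GL (Fin n) F) : Matrix (Fin n) (Fin n) F)) := by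
    intro q
    have h := hread 1 q
    simpa only [one_mul, mul_one, inv_one, Units.val_one, Matrix.one_mul, Matrix.mul_one] using h
  -- the group-side invariance
  have hinv := GLn.unipotentAverage_comp_conj_eq hc κ μN hglc hgcs x
  simp only [hread, h1] at hinv
  exact hinv

end Main

end Summit.HodgeConjecture.HodgeConjecture.Cruxes.H413.K2E3GLnRichardsonLieMeasureAdInvariant

end
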